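import Summits.Ventures.PercRepro.MSTightTwoFamily

/-!
# The cross–within Marica–Schönheim inequality: `|A \\ B ∪ B \\ A| + |D(A) ∪ D(B)| ≥ |A| + |B|`

Dossier proofs/MINE1-theoremS.md, Addendum 71 (mine-1, gen 37). For two arbitrary finite families
`A, B` of finite sets (overlaps allowed, no hypothesis) the **cross differences**
`crossDiffs A B = A \\ B ∪ B \\ A` and the **within differences** `withinDiffs A B = D(A) ∪ D(B)`
satisfy

* **`card_add_card_le_card_crossDiffs_add_card_withinDiffs`**:
  `|A| + |B| ≤ |crossDiffs A B| + |withinDiffs A B|`.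

For `A = B` both sides are `2|D(A)| ≥ 2|A|` (Marica–Schönheim); for `B = ∅` it is Marica–Schönheim
for `A`. It is the two-antipodal-colour case of the lane's candidate inequality (c) of Addendum 70
for the one-family form of (Θ): with `A = G₀` and `B = G₃*`, `crossDiffs A B` is the family of far
meets and far co-joins and `withinDiffs A B` the family of near differences of `G = G₀ ∪ G₃`.

The proof is the Ahlswede–Daykin-style induction on the ground set of `MSTightTwoFamily`
(Addendum 49), here in its simplest form: at an element `r`, both families of differences split
into an `r`-free part and an `r`-part (`part0_diffs`, `partr_diffs`), the union of the two parts
is the same family for the projections `proj r A`, `proj r B` (`crossDiffs_proj`,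
`withinDiffs_proj`), and the intersection of the two parts contains the same family for the
partner families `partner r A`, `partner r B` (`crossDiffs_partner_subset`,
`withinDiffs_partner_subset`): `|Cross| = |Cross'| + |Cross₀ ∩ Cross₁| ≥ |Cross(proj)| + |Cross(partner)|`,
likewise for `Within`, and `|A| = |proj r A| + |partner r A|` closes the induction.
-/

namespace PercRepro.MSTight

open Finset
open scoped FinsetFamily

variable {α : Type*} [DecidableEq α]

/-- The cross differences of two families: `A \\ B ∪ B \\ A`. -/
def crossDiffs (A B : Finset (Finset α)) : Finset (Finset α) := A \\ B ∪ B \\ A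

/-- The within differences of two families: `D(A) ∪ D(B)`. -/
def withinDiffs (A B : Finset (Finset α)) : Finset (Finset α) := A \\ A ∪ B \\ B

section Split

variable (r : α) (A B : Finset (Finset α))

/-- The `r`-free cross differences. -/
theorem part0_crossDiffs : part0 r (crossDiffs A B) = diffsX₂ r A B ∪ diffsX₂ r B A := by
  rw [crossDiffs, part0_union, part0_diffs, part0_diffs]

/-- The `r`-cross differences, with `r` removed. -/
theorem partr_crossDiffs : partr r (crossDiffs A B) = diffsY₂ r A B ∪ diffsY₂ r B A := by
  rw [crossDiffs, partr_union, partr_diffs, partr_diffs]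

/-- The `r`-free within differences. -/
theorem part0_withinDiffs : part0 r (withinDiffs A B) = diffsX r A ∪ diffsX r B := by
  rw [withinDiffs, part0_union, part0_diffs, part0_diffs, diffsX₂_self, diffsX₂_self]

/-- The `r`-within differences, with `r` removed. -/
theorem partr_withinDiffs : partr r (withinDiffs A B) = diffsY r A ∪ diffsY r B := by
  rw [withinDiffs, partr_union, partr_diffs, partr_diffs, diffsY₂_self, diffsY₂_self]

/-- The cross differences of the projections are the union of the two parts. -/
theorem crossDiffs_proj :
    crossDiffs (proj r A) (proj r B) = part0 r (crossDiffs A B) ∪ partr r (crossDiffs A B) := by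
  rw [crossDiffs, diffs_proj_eq₂, diffs_proj_eq₂, part0_crossDiffs, partr_crossDiffs]
  ext E
  simp only [mem_union]
  tauto

/-- The within differences of the projections are the union of the two parts. -/
theorem withinDiffs_proj :
    withinDiffs (proj r A) (proj r B) =
      part0 r (withinDiffs A B) ∪ partr r (withinDiffs A B) := by
  rw [withinDiffs, diffs_proj_eq, diffs_proj_eq, part0_withinDiffs, partr_withinDiffs]
  ext E
  simp only [mem_union]
  tauto

/-- The cross differences of the partner families lie in both parts. -/
theorem crossDiffs_partner_subset :
    crossDiffs (partner r A) (partner r B) ⊆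
      part0 r (crossDiffs A B) ∩ partr r (crossDiffs A B) := by
  intro E hE
  rw [part0_crossDiffs, partr_crossDiffs]
  rw [crossDiffs, mem_union] at hE
  rcases hE with hE | hE
  · obtain ⟨K, hK, K', hK', rfl⟩ := mem_diffs.1 hE
    rw [partner, mem_inter] at hK hK'
    refine mem_inter.2 ⟨?_, ?_⟩
    · exact mem_union.2 (Or.inl (mem_union.2 (Or.inl (mem_union.2 (Or.inl
        (mem_diffs.2 ⟨K, hK.1, K', hK'.1, rfl⟩))))))
    · exact mem_union.2 (Or.inl (mem_diffs.2 ⟨K, hK.2, K', hK'.1, rfl⟩))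
  · obtain ⟨K, hK, K', hK', rfl⟩ := mem_diffs.1 hE
    rw [partner, mem_inter] at hK hK'
    refine mem_inter.2 ⟨?_, ?_⟩
    · exact mem_union.2 (Or.inr (mem_union.2 (Or.inl (mem_union.2 (Or.inl
        (mem_diffs.2 ⟨K, hK.1, K', hK'.1, rfl⟩))))))
    · exact mem_union.2 (Or.inr (mem_diffs.2 ⟨K, hK.2, K', hK'.1, rfl⟩))

/-- The within differences of the partner families lie in both parts. -/
theorem withinDiffs_partner_subset :
    withinDiffs (partner r A) (partner r B) ⊆
      part0 r (withinDiffs A B) ∩ partr r (withinDiffs A B) := by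
  intro E hE
  rw [part0_withinDiffs, partr_withinDiffs]
  rw [withinDiffs, mem_union] at hE
  rcases hE with hE | hE
  · obtain ⟨K, hK, K', hK', rfl⟩ := mem_diffs.1 hE
    rw [partner, mem_inter] at hK hK'
    refine mem_inter.2 ⟨?_, ?_⟩
    · exact mem_union.2 (Or.inl (mem_union.2 (Or.inl (mem_union.2 (Or.inl
        (mem_diffs.2 ⟨K, hK.1, K', hK'.1, rfl⟩))))))
    · exact mem_union.2 (Or.inl (mem_diffs.2 ⟨K, hK.2, K', hK'.1, rfl⟩))
  · obtain ⟨K, hK, K', hK', rfl⟩ := mem_diffs.1 hE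
    rw [partner, mem_inter] at hK hK'
    refine mem_inter.2 ⟨?_, ?_⟩
    · exact mem_union.2 (Or.inr (mem_union.2 (Or.inl (mem_union.2 (Or.inl
        (mem_diffs.2 ⟨K, hK.1, K', hK'.1, rfl⟩))))))
    · exact mem_union.2 (Or.inr (mem_diffs.2 ⟨K, hK.2, K', hK'.1, rfl⟩))

/-- `|Cross(A, B)| = |Cross(proj A, proj B)| + |Cross₀ ∩ Cross₁|`. -/
theorem card_crossDiffs_eq :
    (crossDiffs A B).card = (crossDiffs (proj r A) (proj r B)).card +
      (part0 r (crossDiffs A B) ∩ partr r (crossDiffs A B)).card := by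
  rw [card_eq_card_part0_add_card_partr r (crossDiffs A B), ← card_union_add_card_inter,
    ← crossDiffs_proj]

/-- `|Within(A, B)| = |Within(proj A, proj B)| + |Within₀ ∩ Within₁|`. -/
theorem card_withinDiffs_eq :
    (withinDiffs A B).card = (withinDiffs (proj r A) (proj r B)).card +
      (part0 r (withinDiffs A B) ∩ partr r (withinDiffs A B)).card := by
  rw [card_eq_card_part0_add_card_partr r (withinDiffs A B), ← card_union_add_card_inter,
    ← withinDiffs_proj]

end Split

/-- The induction on the ground set. -/
theorem cross_within_aux (U : Finset α) :
    ∀ A B : Finset (Finset α), (∀ a ∈ A, a ⊆ U) → (∀ b ∈ B, b ⊆ U) →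
      A.card + B.card ≤ (crossDiffs A B).card + (withinDiffs A B).card := by
  induction U using Finset.induction_on with
  | empty =>
    intro A B hA hB
    have hA' : A ⊆ {∅} := fun a ha => mem_singleton.2 (subset_empty.1 (hA a ha))
    have hB' : B ⊆ {∅} := fun b hb => mem_singleton.2 (subset_empty.1 (hB b hb))
    rcases A.eq_empty_or_nonempty with rfl | hAne
    · rcases B.eq_empty_or_nonempty with rfl | hBne
      · simp
      · rw [hBne.subset_singleton_iff.1 hB']
        simp [crossDiffs, withinDiffs]
    · rw [hAne.subset_singleton_iff.1 hA']
      rcases B.eq_empty_or_nonempty with rfl | hBne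
      · simp [crossDiffs, withinDiffs]
      · rw [hBne.subset_singleton_iff.1 hB']
        simp [crossDiffs, withinDiffs]
  | insert r U' hr ih =>
    intro A B hA hB
    have ih1 := ih (proj r A) (proj r B) (proj_subset_of_subset_insert hr hA)
      (proj_subset_of_subset_insert hr hB)
    have ih2 := ih (partner r A) (partner r B) (partner_subset_of_subset_insert hA)
      (partner_subset_of_subset_insert hB)
    have hc := card_crossDiffs_eq r A B
    have hw := card_withinDiffs_eq r A B
    have hc2 := card_le_card (crossDiffs_partner_subset r A B)
    have hw2 := card_le_card (withinDiffs_partner_subset r A B)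
    have hA' := card_eq_card_proj_add_card_partner r A
    have hB' := card_eq_card_proj_add_card_partner r B
    omega

/-- **The cross–within Marica–Schönheim inequality**: for all finite families `A, B`,
`|A \\ B ∪ B \\ A| + |D(A) ∪ D(B)| ≥ |A| + |B|`. -/
theorem card_add_card_le_card_crossDiffs_add_card_withinDiffs (A B : Finset (Finset α)) :
    A.card + B.card ≤ (A \\ B ∪ B \\ A).card + (A \\ A ∪ B \\ B).card :=
  cross_within_aux (A.biUnion id ∪ B.biUnion id) A B
    (fun _ ha => (Finset.subset_biUnion_of_mem id ha).trans subset_union_left)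
    (fun _ hb => (Finset.subset_biUnion_of_mem id hb).trans subset_union_right)

/-- Marica–Schönheim as the case `A = B`. -/
theorem card_le_card_diffs_of_crossWithin (A : Finset (Finset α)) : A.card ≤ (A \\ A).card := by
  have h := card_add_card_le_card_crossDiffs_add_card_withinDiffs A A
  rw [union_self] at h
  omega

end PercRepro.MSTight
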